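import Literature.AnabelianGeometry.EtaleTheta.ArithThetaTowerFrobenioid
import Literature.AnabelianGeometry.EtaleTheta.Discharge.Sec3Cor38iiSelfEquivalenceWeak
import Literature.AnabelianGeometry.EtaleTheta.Discharge.Sec3Def36NonzeroConstants
import Literature.IUT.HodgeTheaters.GenuineFKitOfBadLocalTemperedCFromFSlim
import HarnessLib

/-!
# [EtTh] Cor. 3.8 (ii) at the ARITHMETIC theta tower over `𝒟_v̲ = CosetCat Π_v̲`: the instance hypotheses
# `h5` (C38-L05) and `hR` (Rmk. 3.6.3) AT `C`, and the one-call of `hull_selfEquivalence_weak_of_criteria`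
# (GAP A item GA-14 = D8 part 2)

S. Mochizuki, *The étale theta function and its Frobenioid-theoretic manifestations*, Publ. RIMS **45** (2009)
[MochizukiEtTh2009]: Cor. 3.8 (ii) PDF pp. 80–81 and its proof p. 81 l. 20–27 (the base-field-theoretic pre-step
criterion, row C38-L05), Remark 3.6.3 pp. 78–79, Def. 3.6 (i)/(ii) pp. 76–77, Prop. 3.4 (ii) p. 74, Remark 3.3.1
p. 73 [cite: MochizukiEtTh2009, Cor 3.8 p.81]; *Inter-universal Teichmüller theory I*, Example 3.2 (iii) p. 71
("`𝒞_v ⊆ ℱ̲_v` … may be reconstructed category-theoretically from `ℱ̲_v` [cf. [EtTh], Corollary 3.8, (ii)]") — only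
the [EtTh]-level hypotheses are touched here.

GAP A of record G-L5-EX32I-1 (abc-iut cell), item GA-14 (`plan/GAP-ITEMS.tsv` v0.3 row GA-14; RULINGS #317 (2) as
amended by #319 (c1)–(c4) / #322 (c2′)/(c3′); ruled shapes `plan/L5/GAP-A-SIGNATURES.md` v1 e3ccddf9b87597cf §0/§5;
GAP-SIZING-A.md 69de97346848d3e8 §2 D8).  DOWNSTREAM TYPING RULE (§5): everything is stated over the BINDERS
`(C : TemperedFrobenioid T' T.Dv VD) (hC : ArithThetaTower.CarrierSpec d T C)` of GA-04's decoupling spec S0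
(`ArithThetaTowerFrobenioid.lean` ★ p667989), never over the term `temperedFrobenioid d T` (GA-12); the shared
binders are §0's `{p} [Fact p.Prime] (d : GaloisValDatum.{0} p) {P : Type} [Group P] [TopologicalSpace P]
(T : BadLocalGroupDatum d.Gal P)`, everything at `Type 0`.

WHAT IS HERE (proof-only: 0 definitions, 0 instances, 0 notation, 0 `sorry`).  The L5 consumer of the [EtTh]
Cor. 3.8 (ii) bundle at the merge record (`InitialThetaData.cFromF_frobeniusBadAt_ofRest_of_isSlimGroup`, ★ p511706,
`hds` already discharged there from the slimness of `𝒟_v̲`) takes `{hnd, hF, h5, hR}` on the L2 input; `hnd` is GA-08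
(`isNonDilating_of_carrierSpec hC hD`), `hF` is GA-05 (`isFrobenioid_of_carrierSpec hC`); this file supplies the two
remaining members AT `C`:

* §1 `RealifiedDivisorMonoids.toR_injective_weak` — over the WEAK [FrdI] vocabulary the lattice map
  `Φ₀(Y) → Φ₀^ℝ(Y)` is injective (`Φ₀(Y)` weakly perf-factorial ⇒ divisorial ⇒ `Φ₀ ↪ Φ₀^pf ↪ Φ₀^rlf`).
* §2 what S0 gives: `ratSupport_of_carrierSpec` — `Φ(W)` has RATIONAL SUPPORT in `Φ₀^ℝ(Y_W)` (the binder `hsat`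
  of the weak Cor. 3.8 files) from `CarrierSpec.Φ_carrier` (`Φ = (im Φ₀)^{pf-sat}`); `exists_cnstFn_effective_of_carrierSpec`
  — the bracketed sentence of Def. 3.6 (ii)(b) (`hNZ`: at every `A` a CONSTANT function with non-trivial
  EFFECTIVE divisor in `Φ(A)`) from `CarrierSpec.consts`: the GENUINE constant `p ∈ (Ω^{aug A})^×` (a non-unit
  integer of the `p`-adic field `Ω^{aug A}`, `PadicFld.p_mem`/`p_lt`) embedded by `κ`, whose divisor is its
  genuine valuation `ι(ord p) ≠ 0` read through the (injective) lattice map.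
* §3 **`cor38ii_h5_of_carrierSpec`** — `h5 : C.BsFldPreStepLimitCriterion (PreFrobenioidData.perfection hF)`
  (row C38-L05 at THE perfection) from `hC`, `hF` and the two `T'`-LEVEL print clauses `hP34Λ` ([EtTh] Prop. 3.4
  (ii) at monoid type `Λ`: an element of `B₀^Λ(Y)` with effective divisor is constant) and `hZQ` ([EtTh] Rmk. 3.3.1:
  every prime of `Φ₀(Y)` is a `ℤ`- or `ℚ`-prime) — BY NAME through abc-iut-L6-t12's
  `bsFldPreStepLimitCriterion_of_ratSupport_weak`, with ITS binders `hNZ`, `hsat` DISCHARGED by §2;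
  **`cor38ii_hR`** — `hR : C.Remark363` BY NAME through abc-iut-w5-d135's `remark363_of_isSharp` (sharpness is
  automatic over the weak vocabulary) from the two `T'`-level print clauses `hP34Λ` and `hFinv` ([EtTh] Def. 3.6
  (i)/(ii)(b): `F₀^Λ(Y)` is stable under inverse).
* §4 **the one-call** `hull_selfEquivalence_of_carrierSpec` of `TemperedFrobenioid.hull_selfEquivalence_weak_of_criteria`
  (`Discharge/Sec3Cor38iiSelfEquivalenceWeak.lean`) at `C`: every self-equivalence `e` of `C` preserves the
  base-field-theoretic morphisms and lifts to a compatible self-equivalence of the REAL hull `C^{bs-fld}` — the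
  `ReconstructibleAlong C.hull` clause [IUTchI] Ex. 3.2 (iii) quotes — modulo, BY NAME: `hnd` (GA-08's result type;
  TODO-merge(abc-iut-gapA-08-hndOfCarrierSpec): the variant threading `(hD : CarrierSpec.PullDichotomy C)` through
  `isNonDilating_of_carrierSpec hC hD` is appended when GA-04's add-on `ArithThetaTowerFrobenioidPull.lean` and GA-08
  are in the tree), `hds` (or `Π_v̲` tempered + slim: `…_of_isSlimGroup`), `hF` (GA-05's result type), and the three
  `T'`-level clauses `hP34Λ`, `hZQ`, `hFinv`.

RESIDUALS REPORTED BY NAME (RULINGS #317 (2) «mod named instance facts», for the chair's (iii) wording): after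
GA-05/GA-08, the [EtTh] Cor. 3.8 (ii) bundle at a `C` satisfying S0 is reduced to THREE clauses about the Def. 3.6
(i) data `T'` ALONE — `hP34Λ` (Prop. 3.4 (ii) at `Λ`), `hZQ` (Rmk. 3.3.1), `hFinv` (`F₀^Λ` a group) — each an
INSTANCE-form hypothesis on the given `T'` (never a closed `∀ T'`-schema; the universal closures are REFUTED in tree,
e.g. `TemperedFrobenioid.not_forall_remark363`), and each DISCHARGED at GA-03's `realified d T =
RealifiedDivisorMonoids.ofRlfZWeak (divisorMonoids d T) _` by the landed `B₀`/`Φ₀`-level theorems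
(`RealifiedDivisorMonoids.ofRlfZWeak_mem_FΛ_of_divΛ_eq_of` ⟸ `dm.Prop34`; `hZQ` = GA-02's `ℤ`-primes of
`Φ₀ = (free on components ⊔ cusps) × OrdInt`; `hFinv` ⟸ `hF₀inv`, `F₀(Y) = (Ω^{aug Y})^×` a group) — GA-07's knit.
`hR` does not consume `hC`: no field of S0 constrains `F₀^Λ ⊆ B₀^Λ` beyond the EMBEDDING of the genuine constants
(SIG-DELTA GA-14, reported).

HONEST FRAMING: refereed pre-IUT material ([EtTh] §3 over [FrdI] §§0–5) instantiated at OUR typed objects; an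
UNDISPUTED construction step around [IUTchIII] Cor. 3.12, which stays OPEN by charter (D-0045) — no side is taken on
it or on any author; typed ≠ inhabited ≠ proved-in-print; nothing here asserts the abc conjecture proved or refuted;
count-neutral; rq128 untouched.
-/

noncomputable section

namespace Literature.AnabelianGeometry.EtaleTheta

open CategoryTheory Opposite Function Literature.AlgebraicGeometry.Frobenioids Literature.AnabelianGeometry.SemiGraphs
  Literature.IUT.HodgeTheaters

universe u₀ v₀ w

/-! ## §1 The lattice map `Φ₀ → Φ₀^ℝ` is injective over the weak vocabulary -/

namespace RealifiedDivisorMonoids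

/-- **`Φ₀(Y) → Φ₀^ℝ(Y) = Φ₀(Y)^rlf` is injective** for Def. 3.6 (i) data over the WEAK [FrdI] vocabulary: `Φ₀(Y)` is
weakly perf-factorial, hence divisorial (sharp, integral, saturated), so `Φ₀(Y) → Φ₀(Y)^pf` is injective ([FrdI] §0
p. 11) and `Φ₀(Y)^pf → Φ₀(Y)^rlf` is injective ([FrdI] Def. 2.4 (i)(c), `IsPerfFactorialWeak.Rlf.toRealification_injective`).
[cite: MochizukiFrdI2008, Def. 2.4(i) p.48] -/
theorem toR_injective_weak {D₀ : Type u₀} [Category.{v₀} D₀]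
    (T₁ : RealifiedDivisorMonoids (D₀ := D₀) treeMonoidVocabWeak.{w}) (Y : D₀ᵒᵖ) : Injective (T₁.toR Y) := by
  obtain ⟨h₀, e, he⟩ := (T₁.isRealification Y : IsRealificationViaWeak _ _ _)
  intro a b hab
  have h₁ : h₀.toRealification (Perfection.of _ a) = h₀.toRealification (Perfection.of _ b) := by
    rw [← he, ← he, hab]
  exact of_injective_of_isSharp_isIntegral_isSaturated h₀.isDivisorial.isSharp
    h₀.isDivisorial.isPreDivisorial.isIntegral h₀.isDivisorial.isPreDivisorial.isSaturated
    (IsPerfFactorialWeak.Rlf.toRealification_injective h₀ h₁)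

end RealifiedDivisorMonoids

namespace ArithThetaTower

variable {p : ℕ} [Fact p.Prime] {d : GaloisValDatum.{0} p} {P : Type} [Group P] [TopologicalSpace P]
  {T : BadLocalGroupDatum d.Gal P}
  {T' : RealifiedDivisorMonoids (D₀ := T.Dv) treeMonoidVocabWeak.{0}} {VD : FrdICatStub.{0, 0, 0} T.Dv}
  {C : TemperedFrobenioid T' T.Dv VD}

/-! ## §2 What the decoupling spec S0 gives: rational support (`hsat`) and a non-trivial effective constant (`hNZ`) -/

/-- **Rational support of `Φ(W)` from `CarrierSpec.Φ_carrier`**: `Φ(W) = (im(Φ₀(Y_W) → Φ₀^ℝ(Y_W)))^{pf-sat}`, so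
every `x ∈ Φ(W)` has a power `x^N`, `N ≥ 1`, in the image of the lattice map — the binder `hsat` of the weak
Cor. 3.8 files (Def. 3.6 (i)/(ii) for monoid type `Λ ∈ {ℤ, ℚ}`). [cite: MochizukiEtTh2009, Def 3.6 p.76] -/
theorem ratSupport_of_carrierSpec (hC : CarrierSpec d T C) (W : T.Dv) :
    ∀ x ∈ C.Φ.carrier (op W), ∃ (N : ℕ+) (d₀ : T'.Φ₀.obj (C.baseOp (op W))),
      x ^ (N : ℕ) = T'.toR (C.baseOp (op W)) d₀ := by
  intro x hx
  rw [hC.Φ_carrier] at hx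
  obtain ⟨N, d₀, hd₀⟩ := hx
  exact ⟨N, d₀, hd₀.symm⟩

/-- The image of the lattice map lies in `Φ(A)` (`im ⊆ im^{pf-sat}`, `CarrierSpec.Φ_carrier`).
[cite: MochizukiEtTh2009, Def 3.6 p.76] -/
theorem toR_mem_carrier_of_carrierSpec (hC : CarrierSpec d T C) (A : T.Dvᵒᵖ) (z : T'.Φ₀.obj (C.baseOp A)) :
    T'.toR (C.baseOp A) z ∈ C.Φ.carrier A := by
  rw [hC.Φ_carrier]
  exact le_perfSaturation _ ⟨z, rfl⟩

/-- **Def. 3.6 (ii)(b), bracketed sentence (`hNZ`), from the GENUINE CONSTANTS of S0** ("the image of `F(A)` in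
`(Φ^{bs-fld})^gp(A)` contains a nonzero element of `Φ^{bs-fld}(A)`", p. 77): at every `A ∈ Ob(𝒟_v̲)` the genuine
constant `p ∈ (Ω^{aug A})^×` — an integer of the `p`-adic field `Ω^{aug A}` of valuation `< 1` (`PadicFld.p_mem`,
`PadicFld.p_lt`) — embeds by `κ` (`CarrierSpec.consts`) as a constant function `κ(p) ∈ F₀^Λ(Y_A)` whose divisor is
the EFFECTIVE element `ι(ord p)` of the lattice read in `Φ₀^ℝ`, non-trivial because `ord p ≠ 0`, `ι` is injective
and the lattice map is injective (§1). [cite: MochizukiEtTh2009, Def 3.6 p.77] -/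
theorem exists_cnstFn_effective_of_carrierSpec (hC : CarrierSpec d T C) (A : T.Dvᵒᵖ) :
    ∃ u : (T'.BΛ.obj (C.baseOp A) : Type) × Algebra.GrothendieckGroup (C.Φ.carrier A),
      u ∈ C.cnstFn A ∧ ∃ Z : C.Φ.carrier A, Z ≠ 1 ∧ u.2 = Algebra.GrothendieckGroup.of Z := by
  obtain ⟨κ, ι, -, hι, hκF, -, hdiv⟩ := hC.consts
  -- the genuine constant `p` of the `p`-adic field `Ω^{aug A}`
  set X : PadicFrd.PadicFld.{0} p := d.fieldFunctor.obj (T.proj.obj (unop (C.baseOp A))) with hX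
  let x : PadicFrd.intNonzero X.K := ⟨((p : ℕ) : X.K), X.p_mem⟩
  have hx1 : Associates.mk x ≠ 1 := by
    rw [Ne, Associates.mk_eq_one, PadicFrd.isUnit_intNonzero_iff]
    exact X.p_lt.ne
  let u : (X.K)ˣ := PadicFrd.intNonzeroToUnits X.K x
  -- its divisor, read through the lattice map
  let z : T'.Φ₀.obj (C.baseOp A) := ι (C.baseOp A) (Associates.mk x)
  have hz : T'.toR (C.baseOp A) z ∈ C.Φ.carrier A := toR_mem_carrier_of_carrierSpec hC A z
  have hZ1 : (⟨T'.toR (C.baseOp A) z, hz⟩ : C.Φ.carrier A) ≠ 1 := by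
    intro h
    have h' : T'.toR (C.baseOp A) z = T'.toR (C.baseOp A) 1 := by
      rw [map_one]; exact congrArg Subtype.val h
    have hz1 : z = 1 := RealifiedDivisorMonoids.toR_injective_weak T' _ h'
    exact hx1 (hι (C.baseOp A) (hz1.trans (map_one (ι (C.baseOp A))).symm))
  refine C.exists_cnstFn_effective_of_divΛ_eq (hκF (C.baseOp A) u) hZ1 ?_
  rw [hdiv (C.baseOp A) u]
  change gpMap (T'.toR (C.baseOp A)) (gpMap (ι (C.baseOp A))
    (PadicFrd.divUnits X.K (PadicFrd.intNonzeroToUnits X.K x))) = _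
  rw [PadicFrd.divUnits_intNonzeroToUnits, gpMap_of, gpMap_of]
  rfl

/-! ## §3 The instance hypotheses `h5` (row C38-L05) and `hR` (Remark 3.6.3) AT `C` -/

/-- **`h5` — row C38-L05 of the proof of [EtTh] Cor. 3.8 at THE perfection of `C`, from the decoupling spec S0**
("a pre-step of `C` is base-field-theoretic if and only if its image in `C^pf` is a [filtered] projective limit in
`(C^pf)^coa-pre_B` of pre-steps abstractly equivalent to an endomorphism in `O^▷(−)`", p. 81): BY NAME through
abc-iut-L6-t12's `bsFldPreStepLimitCriterion_of_ratSupport_weak`, whose binders `hsat` (rational support) and `hNZ`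
(a non-trivial effective constant) are DISCHARGED from `hC` (§2); what remains are `hF` ([FrdI] Thm. 5.2 (ii) — GA-05's
`isFrobenioid_of_carrierSpec hC`) and the two `T'`-level print clauses `hP34Λ` (Prop. 3.4 (ii) at monoid type `Λ`)
and `hZQ` (Rmk. 3.3.1), INSTANCE-form hypotheses on the given Def. 3.6 (i) data. [cite: MochizukiEtTh2009, Cor 3.8 p.81] -/
theorem cor38ii_h5_of_carrierSpec (hC : CarrierSpec d T C) (hF : PreFrobenioid.IsFrobenioid C.toElem)
    (hP34Λ : ∀ (Y : T.Dvᵒᵖ) (b : T'.BΛ.obj Y) (r : T'.ΦR.obj Y),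
      T'.divΛ Y b = Algebra.GrothendieckGroup.of r → b ∈ T'.FΛ Y)
    (hZQ : ∀ (Y : T.Dvᵒᵖ) (𝔭 : Primes (T'.Φ₀.obj Y)), IsZMonoprime ↥𝔭.submonoid ∨ IsQMonoprime ↥𝔭.submonoid) :
    C.BsFldPreStepLimitCriterion (PreFrobenioidData.perfection hF) :=
  C.bsFldPreStepLimitCriterion_of_ratSupport_weak hF hP34Λ (exists_cnstFn_effective_of_carrierSpec hC)
    (fun W => hZQ (C.baseOp (op W))) (ratSupport_of_carrierSpec hC)

/-- **`hR` — [EtTh] Remark 3.6.3 at `C`** ("the natural functor `C^{bs-fld} → C` is isomorphism-full", and its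
essential image on morphisms is the base-field-theoretic morphisms, pp. 78–79): BY NAME through abc-iut-w5-d135's
`remark363_of_isSharp` — `Φ(A)` is weakly perf-factorial over the weak vocabulary, hence divisorial, hence sharp —
from the two `T'`-level print clauses `hP34Λ` (Prop. 3.4 (ii) at `Λ`) and `hFinv` (Def. 3.6 (i)/(ii)(b): `F₀^Λ(Y)`
is stable under inverse), INSTANCE-form hypotheses on the given data `T'`.  (No field of S0 bears on
`F₀^Λ ⊆ B₀^Λ` beyond the embedding of the genuine constants, so `hC` is not a binder here.)
[cite: MochizukiEtTh2009, Rmk 3.6.3 p.79] -/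
theorem cor38ii_hR (C : TemperedFrobenioid T' T.Dv VD)
    (hP34Λ : ∀ (Y : T.Dvᵒᵖ) (b : T'.BΛ.obj Y) (r : T'.ΦR.obj Y),
      T'.divΛ Y b = Algebra.GrothendieckGroup.of r → b ∈ T'.FΛ Y)
    (hFinv : ∀ (Y : T.Dvᵒᵖ) (b : T'.BΛ.obj Y), b ∈ T'.FΛ Y → ∃ b' ∈ T'.FΛ Y, b' * b = 1) :
    C.Remark363 :=
  C.remark363_of_isSharp (fun A => (C.objectwise_isDivisorial_weak A).isSharp) hP34Λ hFinv

/-! ## §4 The one-call of `TemperedFrobenioid.hull_selfEquivalence_weak_of_criteria` at `C` -/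

/-- **[EtTh] Cor. 3.8 (ii) for every SELF-equivalence `e : C ⥲ C` of a tempered Frobenioid `C` over
`𝒟_v̲ = CosetCat Π_v̲` satisfying the decoupling spec S0** — the shape [IUTchI] Ex. 3.2 (iii) quotes ("`𝒞_v ⊆ ℱ̲_v`
… may be reconstructed category-theoretically from `ℱ̲_v`"): `e` preserves the base-field-theoretic morphisms AND
lifts to a self-equivalence `e'` of the REAL hull category `C^{bs-fld}` with `hull ⋙ e ≅ e' ⋙ hull` (the
`ReconstructibleAlong C.hull` clause).  ONE CALL of `TemperedFrobenioid.hull_selfEquivalence_weak_of_criteria` with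
`hD :=` abc-iut-L5's `BadLocalFrobenioid.isOfFSMFFType_Dv d T` (`CosetCat Π_v̲` is of FSM-, hence FSMFF-type, [FrdII]
Ex. 1.3 (i)), `h5 := cor38ii_h5_of_carrierSpec`, `hR := cor38ii_hR`; modulo, BY NAME: `hnd` (GA-08's
`isNonDilating_of_carrierSpec hC hD'` — its result type; TODO-merge(abc-iut-gapA-08-hndOfCarrierSpec)), `hds`
(Div-slimness of `𝒟_v̲` relative to `Φ`; discharged in `…_of_isSlimGroup`), `hF` (GA-05's `isFrobenioid_of_carrierSpec hC`
— its result type), and the three `T'`-level clauses `hP34Λ`, `hZQ`, `hFinv`. [cite: MochizukiEtTh2009, Cor 3.8 p.81] -/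
theorem hull_selfEquivalence_of_carrierSpec [IsTopologicalGroup P] (hC : CarrierSpec d T C)
    (hnd : ∀ (A : T.Dvᵒᵖ) (f : A ⟶ A), treeMonoidVocabWeak.{0}.IsNonDilating (C.Φ.carrier A) (C.Φ.pull f))
    (hds : ∀ (A : T.Dv) (α : Aut (Over.forget A)),
      (∀ (B : Over A) (x : C.divisorMonoid.obj (op B.left)),
        Literature.AlgebraicGeometry.Frobenioids.pull C.divisorMonoid (α.hom.app B) x = x) → α = 1)
    (hF : PreFrobenioid.IsFrobenioid C.toElem)
    (hP34Λ : ∀ (Y : T.Dvᵒᵖ) (b : T'.BΛ.obj Y) (r : T'.ΦR.obj Y),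
      T'.divΛ Y b = Algebra.GrothendieckGroup.of r → b ∈ T'.FΛ Y)
    (hZQ : ∀ (Y : T.Dvᵒᵖ) (𝔭 : Primes (T'.Φ₀.obj Y)), IsZMonoprime ↥𝔭.submonoid ∨ IsQMonoprime ↥𝔭.submonoid)
    (hFinv : ∀ (Y : T.Dvᵒᵖ) (b : T'.BΛ.obj Y), b ∈ T'.FΛ Y → ∃ b' ∈ T'.FΛ Y, b' * b = 1)
    (e : C.category ≌ C.category) :
    (∀ {A B : C.category} (f : A ⟶ B), C.IsBaseFieldTheoretic f ↔ C.IsBaseFieldTheoretic (e.functor.map f)) ∧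
      ∃ e' : C.hullCategory ≌ C.hullCategory, Nonempty (C.hull ⋙ e.functor ≅ e'.functor ⋙ C.hull) :=
  TemperedFrobenioid.hull_selfEquivalence_weak_of_criteria C (BadLocalFrobenioid.isOfFSMFFType_Dv d T) hnd hds hF
    (cor38ii_h5_of_carrierSpec hC hF hP34Λ hZQ) (cor38ii_hR C hP34Λ hFinv) e

/-- **The same with `hds` DISCHARGED from `Π_v̲` tempered and slim** — ★ p511706's
`BadLocalFrobenioid.divSlim_cosetCat_of_isSlimGroup` BY NAME ([SemiAnbd] Rmk. 3.4.1: `CosetCat Π_v̲` is then a slim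
category, so every `(𝒟_v̲)_A → 𝒟_v̲` is rigid whatever the action on divisors; at the kit `hP`/`hZ` are ★ p497246
`isTempered_badPair_of_isClosed` and the (vi)(d) group binder): [EtTh] Cor. 3.8 (ii) for every self-equivalence of `C`,
modulo `hnd` (GA-08), `hF` (GA-05) and the three `T'`-level clauses only. [cite: MochizukiEtTh2009, Cor 3.8 p.81] -/
theorem hull_selfEquivalence_of_carrierSpec_of_isSlimGroup [IsTopologicalGroup P] (hC : CarrierSpec d T C)
    (hP : IsTempered P) (hZ : IsSlimGroup P)
    (hnd : ∀ (A : T.Dvᵒᵖ) (f : A ⟶ A), treeMonoidVocabWeak.{0}.IsNonDilating (C.Φ.carrier A) (C.Φ.pull f))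
    (hF : PreFrobenioid.IsFrobenioid C.toElem)
    (hP34Λ : ∀ (Y : T.Dvᵒᵖ) (b : T'.BΛ.obj Y) (r : T'.ΦR.obj Y),
      T'.divΛ Y b = Algebra.GrothendieckGroup.of r → b ∈ T'.FΛ Y)
    (hZQ : ∀ (Y : T.Dvᵒᵖ) (𝔭 : Primes (T'.Φ₀.obj Y)), IsZMonoprime ↥𝔭.submonoid ∨ IsQMonoprime ↥𝔭.submonoid)
    (hFinv : ∀ (Y : T.Dvᵒᵖ) (b : T'.BΛ.obj Y), b ∈ T'.FΛ Y → ∃ b' ∈ T'.FΛ Y, b' * b = 1)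
    (e : C.category ≌ C.category) :
    (∀ {A B : C.category} (f : A ⟶ B), C.IsBaseFieldTheoretic f ↔ C.IsBaseFieldTheoretic (e.functor.map f)) ∧
      ∃ e' : C.hullCategory ≌ C.hullCategory, Nonempty (C.hull ⋙ e.functor ≅ e'.functor ⋙ C.hull) :=
  hull_selfEquivalence_of_carrierSpec hC hnd (BadLocalFrobenioid.divSlim_cosetCat_of_isSlimGroup hP hZ C.divisorMonoid)
    hF hP34Λ hZQ hFinv e

end ArithThetaTower

end Literature.AnabelianGeometry.EtaleTheta

end
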